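import Summits.QuantumFields.BalabanUV.Beta.WilsonLetterSocketFit
import Summits.QuantumFields.BalabanUV.Beta.ColourBasisSU

/-!
# `BalabanUV.Beta.WilsonLetterColourFree` — binder row D1, W-side leaf (W-0W), stage S3e: **THE WILSON (2,2) REFLECTION LAW AND THE
# hR END's WILSON HYPOTHESES WITH NO COLOUR DATA** (β sub-cell, row BETA-an3, lineage an3 gen 32)

HONEST FRAMING (cell charter, verbatim): «discharging BetaPertH makes Balaban's UV stability UNCONDITIONAL — a real
constructive-QFT result; it is NOT the continuum limit and NOT the Clay problem.»  Neutral kernel algebra ([folklore]) on OUR tables; no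
statement of Bałaban's papers, no `[cite:]`, no `Prop` fact; instantiates no binder of the wall.  NOT D1, NOT `BetaPertH`, NOT continuum,
NOT Clay.

PURPOSE.  The W-0W chain (`WilsonJetReflection2*`, `WilsonStencilReflection2`, `WilsonReflectionContact2`, `WilsonLetterSocketFit`) derives
the axis-reflection law of the Wilson bi-stencil `wilsonW₂ d (wsym22 N)` from the plaquette jets, and therefore states it for an arbitrary
generator family `τ : C → Matrix (Fin N) (Fin N) ℂ` with `(hτ : Complete τ) (ho : TrOrthonormal τ)` and an external colour `(c : C)` —
although the CONCLUSIONS mention `N` only (`wsym22 N` is a real table).  With the explicit family of record `ColourBasisSU.suGen N`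
(`√N ·` generalized Gell-Mann; `suGen_complete`, `suGen_trOrthonormal`) and the index `ColourBasisSU.diagIndex` these three binders are
discharged once and for all: below, the law (§1) and the hR END's Wilson hypotheses (hWff)/(canonical `ff` law) (§2) under the SINGLE side
condition `2 ≤ N`.  So the row owner's wall instantiation of `SpineRecursiveT2AllCanon.…_of_letters_canon` at `T := (8N²)⁻¹ • wsym22 N`,
`RW := 0` needs NO colour data: `(hWff := wilsonW₂_letter_ff_canon_step_su hN (toSite (ctrOff 4 Lc)) Lc)` with `hN : 2 ≤ N`, and
(hRWl)/(hRWr)/(hRWc)/(hRWp) from `WilsonLetterSocketFit.zeroLetter_*` (colour-free already).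
Provenance: β sub-cell, unit beta-an3 gen 32, 2026-08-20 (v1); no existing file touched.
-/

namespace Summit.QuantumFields.BalabanUV.Beta.WilsonLetterColourFree

open Literature.MathematicalPhysics.QuantumFieldTheory.Balaban1983to89
open Literature.MathematicalPhysics.QuantumFieldTheory.Balaban1983to89.Beta
open WilsonVertex2Sym (wsym22)
open WilsonBiStencil (wilsonW₂)
open StepJetData (wilsonA)
open ResolventReflection (bref Φ)
open PolarizationSign (reflSign)
open KernelReflection (refK)
open ExpKernelCalculus (MKer)
open OneStepResolventKernel (Fib)
open Summit.QuantumFields.BalabanUV.Beta.ChartConjugation (conjW)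
open Summit.QuantumFields.BalabanUV.Beta.BorderedHessian (diagK ctGen bhKAt bhKStepAt)
open Summit.QuantumFields.BalabanUV.Beta.WilsonReflectionContact2 (wilsonP wilsonHH wilsonW₂_wsym22_bref wilsonW₂_bref_ff_canon_bhKAt)
open Summit.QuantumFields.BalabanUV.Beta.WilsonLetterSocketFit (wilsonW₂_letter_ff_canon_step wilsonW₂_letter_ff_canon_step')
open Summit.QuantumFields.BalabanUV.Beta.ColourBasisSU (suGen suGen_complete suGen_trOrthonormal diagIndex ne_zero_of_two_le)

variable {d : ℕ} {N : ℕ}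

/-! ## §1 The (2,2) reflection law of `wilsonW₂ d (wsym22 N)`, colour-free -/

/-- [folklore] **THE (2,2) AXIS-REFLECTION LAW WITH CONTACT, NO COLOUR DATA** (`2 ≤ N`): `WilsonReflectionContact2.wilsonW₂_wsym22_bref`
read at the family of record `suGen N` and the colour `diagIndex` — all four fibre blocks, no remainder. -/
theorem wilsonW₂_wsym22_bref_su (hN : 2 ≤ N) (L : ℕ) (α κ₁ κ₂ : Fin (d + 1)) (u₁ u₂ : Fin (d + 1) → ℤ) :
    wilsonW₂ d (wsym22 N) κ₁ (bref α κ₁ u₁) κ₂ (bref α κ₂ u₂) =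
      (reflSign α κ₁ * reflSign α κ₂) • refK (Φ L α)
        (wilsonW₂ d (wsym22 N) κ₁ u₁ κ₂ u₂ + conjW (wilsonP d N) (wilsonA d κ₁ u₁) (wilsonA d κ₂ u₂)
          (diagK fun p c => -(4 * (N : ℝ) ^ 2) * ctGen d α L κ₁ u₁ p c) (diagK fun p c => -(4 * (N : ℝ) ^ 2) * ctGen d α L κ₂ u₂ p c)
          (diagK (wilsonHH d N α L κ₁ u₁ κ₂ u₂))) :=
  wilsonW₂_wsym22_bref (suGen_complete (ne_zero_of_two_le hN)) (suGen_trOrthonormal N) (ne_zero_of_two_le hN) (diagIndex hN) L α κ₁ κ₂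
    u₁ u₂

/-- [folklore] **THE CANONICAL `ff` LAW AT THE TABLE `(8N²)⁻¹ • wsym22 N`, NO COLOUR DATA** (`2 ≤ N`; the row owner's `hQff` shape with
`𝕄 := bhKAt d ρ L′`, `κ₁ := −½`, canonical second symbol, `R₀ := 0`): `WilsonReflectionContact2.wilsonW₂_bref_ff_canon_bhKAt` at `suGen N`. -/
theorem wilsonW₂_bref_ff_canon_bhKAt_su (hN : 2 ≤ N) (ρ : Fin (d + 1) → ℤ) (L' L : ℕ) (α κ₁ κ₂ : Fin (d + 1))
    (u₁ u₂ x z : Fin (d + 1) → ℤ) (β β' : Fin (d + 1)) :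
    wilsonW₂ d ((8 * (N : ℝ) ^ 2)⁻¹ • wsym22 N) κ₁ (bref α κ₁ u₁) κ₂ (bref α κ₂ u₂) x z (Sum.inl β) (Sum.inl β') =
      ((reflSign α κ₁ * reflSign α κ₂) • refK (Φ (d := d) L α)
        (wilsonW₂ d ((8 * (N : ℝ) ^ 2)⁻¹ • wsym22 N) κ₁ u₁ κ₂ u₂ +
          conjW (bhKAt d ρ L') (wilsonA d κ₁ u₁) (wilsonA d κ₂ u₂) (diagK fun p c => (-(1 / 2) : ℝ) * ctGen d α L κ₁ u₁ p c)
            (diagK fun p c => (-(1 / 2) : ℝ) * ctGen d α L κ₂ u₂ p c)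
            (diagK fun p c => (-(1 / 2) : ℝ) ^ 2 * (ctGen d α L κ₁ u₁ p c * ctGen d α L κ₂ u₂ p c)))) x z (Sum.inl β) (Sum.inl β') :=
  wilsonW₂_bref_ff_canon_bhKAt (suGen_complete (ne_zero_of_two_le hN)) (suGen_trOrthonormal N) (ne_zero_of_two_le hN) (diagIndex hN) ρ L'
    L α κ₁ κ₂ u₁ u₂ x z β β'

/-! ## §2 The hR END's hypothesis (hWff) in its literal shape, colour-free -/

/-- [folklore] **(hWff) IN ITS LITERAL SHAPE, ZERO RESIDUAL, NO COLOUR DATA** (`2 ≤ N`): `WilsonLetterSocketFit.wilsonW₂_letter_ff_canon_step`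
at `suGen N` — binder order `α κ u κ′ u′ x z β β′`, step Hessian `bhKStepAt d ρ L 0`, coefficients `(-(1 / 2 : ℝ))`, `(-(1 / 2 : ℝ)) ^ 2`, the
residual slot `+ 0`; at the wall `d := 3`, `ρ := toSite (ctrOff 4 Lc)`, `L := Lc`. -/
theorem wilsonW₂_letter_ff_canon_step_su (hN : 2 ≤ N) (ρ : Fin (d + 1) → ℤ) (L : ℕ) [NeZero L] :
    ∀ (α κ : Fin (d + 1)) (u : Fin (d + 1) → ℤ) (κ' : Fin (d + 1)) (u' : Fin (d + 1) → ℤ) (x z : Fin (d + 1) → ℤ) (β β' : Fin (d + 1)),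
      wilsonW₂ d ((8 * (N : ℝ) ^ 2)⁻¹ • wsym22 N) κ (bref α κ u) κ' (bref α κ' u') x z (Sum.inl β) (Sum.inl β') =
        ((reflSign α κ * reflSign α κ') • refK (Φ L α)
          (wilsonW₂ d ((8 * (N : ℝ) ^ 2)⁻¹ • wsym22 N) κ u κ' u' +
            conjW (bhKStepAt d ρ L 0) (wilsonA d κ u) (wilsonA d κ' u')
              (diagK fun p c => (-(1 / 2 : ℝ)) * ctGen d α L κ u p c) (diagK fun p c => (-(1 / 2 : ℝ)) * ctGen d α L κ' u' p c)
              (diagK fun p c => (-(1 / 2 : ℝ)) ^ 2 * (ctGen d α L κ u p c * ctGen d α L κ' u' p c)) +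
            (0 : Fin (d + 1) → Fin (d + 1) → (Fin (d + 1) → ℤ) → Fin (d + 1) → (Fin (d + 1) → ℤ) → MKer (d + 1) (Fib d)) α κ u κ' u'))
          x z (Sum.inl β) (Sum.inl β') :=
  wilsonW₂_letter_ff_canon_step (suGen_complete (ne_zero_of_two_le hN)) (suGen_trOrthonormal N) (ne_zero_of_two_le hN) (diagIndex hN) ρ L

/-- [folklore] (hWff) without the residual slot, colour-free (`2 ≤ N`): `WilsonLetterSocketFit.wilsonW₂_letter_ff_canon_step'` at `suGen N`. -/
theorem wilsonW₂_letter_ff_canon_step'_su (hN : 2 ≤ N) (ρ : Fin (d + 1) → ℤ) (L : ℕ) [NeZero L] (α κ : Fin (d + 1))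
    (u : Fin (d + 1) → ℤ) (κ' : Fin (d + 1)) (u' : Fin (d + 1) → ℤ) (x z : Fin (d + 1) → ℤ) (β β' : Fin (d + 1)) :
    wilsonW₂ d ((8 * (N : ℝ) ^ 2)⁻¹ • wsym22 N) κ (bref α κ u) κ' (bref α κ' u') x z (Sum.inl β) (Sum.inl β') =
      ((reflSign α κ * reflSign α κ') • refK (Φ L α)
        (wilsonW₂ d ((8 * (N : ℝ) ^ 2)⁻¹ • wsym22 N) κ u κ' u' +
          conjW (bhKStepAt d ρ L 0) (wilsonA d κ u) (wilsonA d κ' u')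
            (diagK fun p c => (-(1 / 2 : ℝ)) * ctGen d α L κ u p c) (diagK fun p c => (-(1 / 2 : ℝ)) * ctGen d α L κ' u' p c)
            (diagK fun p c => (-(1 / 2 : ℝ)) ^ 2 * (ctGen d α L κ u p c * ctGen d α L κ' u' p c))))
        x z (Sum.inl β) (Sum.inl β') :=
  wilsonW₂_letter_ff_canon_step' (suGen_complete (ne_zero_of_two_le hN)) (suGen_trOrthonormal N) (ne_zero_of_two_le hN) (diagIndex hN)
    ρ L α κ u κ' u' x z β β'

end Summit.QuantumFields.BalabanUV.Beta.WilsonLetterColourFree
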